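import Summits.BirchSwinnertonDyer.Rank1Residual.X10.SecondDescentNine
import Summits.BirchSwinnertonDyer.Rank1Residual.X10.CasselsTatePairingGram
import Literature.GroupTheory.FiniteAbelian.AlternatingPairing
import Literature.NumberTheory.EllipticCurves.BSDShaProofs
import HarnessLib

/-!
# ONE second-3-descent line + the Cassels–Tate pairing (bsd.S18, displayed) ⇒ `Ш[9] = Ш[3]` ⇒ `BSD(E,3)` at a rank-`0` pair with `#Sel^(3) = 9`, `ord₃ #Ш_an = 2` — the route-C9 door with ONE emptiness document instead of four (cell `b2b-bsdres`, unit `b2b-bsdres-x10`, gen 51)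

HONEST FRAMING (run/shared/lean/b2b/bsd-rank1-residual/, verbatim in every file): the goal of the
cell is to DELETE the COMBINATION-SHAPED residual classes of the Birch–Swinnerton-Dyer formula for
ALL analytic-rank `≤ 1` elliptic curves over `ℚ` — "full BSD formula for every rank `≤ 1` curve in
class `C`" assembled STRICTLY from published theorems — so that the rank-`≤ 1` remainder becomes
exactly the CONSTRUCTION-SHAPED classes, which are TYPED (missing-input `Prop`s), NOT attempted.
This is not "finishing BSD". Theorems only (no definition, no new named fact); NOTHING IS BOOKED
here; no class label changes (X10b stays CONSTRUCTION-SHAPED / NEEDS X_A3; X11a / X4 / X7 / X8 keep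
their marks). Per pair.

**What this file is.** Route C9 (`X10/SecondDescentNine.lean`, p556861) books `BSD(E,3)` at a rank-`0`
pair with `E[3]` irreducible, `#Sel^(3)(E/ℚ) = 9`, `ord₃ #Ш_an = 2` from the binder
`h9 : ∀ x : Ш, 3 • x = 0 → x ≠ 0 → ∀ z, 3 • z ≠ x` — FOUR second-3-descent EMPTINESS documents per
curve, one per line `⟨η⟩ ⊂ Sel^(3) = Ш[3]` (B. Creutz, Math. Comp. 83 (2014) §7), PAIRING-FREE. This
file proves, in the kernel, that under the Cassels–Tate pairing fact **bsd.S18** (Cassels, J. reine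
angew. Math. 211 (1962) = Silverman AEC X.4.14: a bi-additive ALTERNATING pairing `Ш × Ш → ℚ/ℤ` whose
kernel is the subgroup of divisible elements — the tree's named fact
`WeierstrassCurve.exists_casselsTate_pairing`, DISPLAYED as the binder `hCT` exactly as the cell's and
bsd-print-x11a's 3-descent records display it) ONE such document suffices:

* `sq_nsmul_stable_of_oneNonDivisible` (§1, pure algebra): a FINITE additive group `A` with an
  alternating non-degenerate bi-additive `B : A × A → ℚ/ℤ`, `#A[p] = p²`, and ONE `x₀ ∈ A[p] ∖ 0` that
  is not a `p`-th multiple has `A[p²] = A[p]`. Proof: the orthogonal of `A[p]` is `pA`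
  (`Literature.GroupTheory.FiniteAbelian.mem_range_nsmul_of_forall_torsionBy`: the induced pairing
  `A[p] × A/pA → 𝔽_p` has trivial left kernel and `#A[p] = #A/pA`), so `x₀ ∉ pA` has a partner
  `y₀ ∈ A[p]` with `B x₀ y₀ ≠ 0`; alternation gives `B y₀ x₀ = −B x₀ y₀ ≠ 0` and `B x₀ x₀ = B y₀ y₀ = 0`,
  i.e. `(x₀, y₀)` is a GRAM PAIR in the sense of `X10/CasselsTatePairingGram.lean`, whose
  `sq_nsmul_stable_of_gram` (span by counting + non-degeneracy on `A[p]` + one line of bilinearity)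
  concludes. For `Ш(E/K)` this is Cassels' "the kernel of `⟨·,·⟩` on `Ш[p] × Ш[p]` is `pШ ∩ Ш[p]`"
  (Cassels 1998 §1; Fisher 2003 §1), here DERIVED from the printed form of X.4.14 plus finiteness.
* `shaNoPSqTorsion_of_oneNonDivisible_of_card_selmerGroup` (§2, any number field, rank `0`,
  `p ∤ #E(K)_tors`, `Ш` finite, `#Sel^(p) = p²` — so `#Ш[p] = p²` by p213922's PROVED bijection):
  `hCT` + ONE non-divisible non-zero `p`-torsion class ⇒ `Ш[p²] = Ш[p]`; `noDivisibleTorsion_of_oneNonDivisible`: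
  hence the FULL route-C9 binder `h9` (so under `hCT` the one-line binder and the four-line binder are
  EQUIVALENT — the other three documents of a C9 record are corroboration, not input).
* `bsdp_of_oneNonDivisible_of_card_selmerGroup` / `padicValNat_shaOrder_eq_two_of_oneNonDivisible`
  (§3, over `ℚ`: Gross–Zagier–Kolyvagin `hGZK` for rank and finiteness) and the record shape
  `bsdp_three_of_ainvs_of_oneNonDivisible` (§4: literal minimal model, `E[3]` irreducible decided in
  the kernel from one Frobenius point count, as `bsdp_three_of_ainvs_of_noDivisibleTorsion`).

**The binder the certificate discharges** is `h1 : ∃ x : Ш(E/ℚ), 3 • x = 0 ∧ x ≠ 0 ∧ ∀ z, 3 • z ≠ x`: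
ONE route-C9 line — a plane cubic `C_η`, `[C_η] = η ∈ Sel^(3) ∖ 0 = Ш[3] ∖ 0` (rank `0`, `E(ℚ)[3] = 0`),
whose algebraic `3`-Selmer set is EMPTY on TWO engines written apart (`ninedesc.gp` with `F(S,3)`
certified complete — `bnfcertify(bnf,1) = 1` or the kit-`c9cert` class-group certificate —, and
`ninedesc_e2.py`), i.e. `η ∉ 3·Sel^(9)`, i.e. `[C_η]` is not divisible by `3` in `Ш` (Creutz 2014
Thm. 7.2). WHY THIS MATTERS: the cost of a line is governed by its flex field `F` (degree 9); per curve
the four flex discriminants spread over many orders of magnitude (e.g. `143973e1`: `1.3·10²⁶` on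
`η₁η₂` vs `8.3·10²⁹` on `η₂`, `η₁η₂²`), and PARI's Zimmert bound `B_Z = 2.457·10⁻⁴·√|d_F|` prices the
class-group certification at `10² … 10⁵` core-hours per line; the one-line door lets the pipeline
certify the CHEAPEST line only. What it costs: the displayed binder `hCT` (a THEOREM in print since
1962, priced by the desk as on every `hCT`-displaying record; no pairing VALUE is computed — no
Fisher–Newton Gram matrix, no norm equation). The four-line PAIRING-FREE door remains available and
every four-line record stands.

References: Cassels 1962 (IV) [Cassels1962ArithmeticIV]; Silverman AEC Thm. X.4.14 and X.4.2
[SilvermanAEC2009]; Cassels 1998 §1 [Cassels1998]; B. Creutz, Math. Comp. 83 (2014) Thm. 7.2,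
Alg. 7.3 [Creutz2014]; R. L. Miller 2011 Def. 1.1 [Miller2011LMS]; B. Mazur 1978 Prop. 6.3 (1)
[Mazur1978]; companions `X10/SecondDescentNine` (p556861), `X10/CasselsTatePairingGram`,
`X10/CasselsTatePairingCertificate` (p213922), `Literature/GroupTheory/FiniteAbelian/AlternatingPairing`;
cell files X10-AUDIT.md §51–§57.
-/

set_option autoImplicit false

noncomputable section

open scoped Classical AddSubgroup

open WeierstrassCurve Literature.NumberTheory.EllipticCurves
  Literature.NumberTheory.EllipticCurves.Rank1Residual
  Literature.NumberTheory.EllipticCurves.Rank1Residual.Typed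
  Literature.NumberTheory.EllipticCurves.Rank1Residual.X11RankOneCertificates
  Literature.GroupTheory.FiniteAbelian
  Summit.BirchSwinnertonDyer.BirchSwinnertonDyer.Rank1Residual.IntModel
  Summit.BirchSwinnertonDyer.BirchSwinnertonDyer.Rank1Residual.X11RankOne
  Summit.BirchSwinnertonDyer.Rank1Residual.X11b

namespace Summit.BirchSwinnertonDyer.Rank1Residual.X10

/-! ### §1 Algebra: one non-divisible `p`-torsion element under an alternating non-degenerate `ℚ/ℤ`-pairing -/

section Algebra

variable {A : Type*} [AddCommGroup A]

/-- **A partner for a non-divisible `p`-torsion element.** For a finite additive group `A` with an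
alternating non-degenerate bi-additive pairing `B : A × A → ℚ/ℤ`, an element `x₀` that is NOT a
`p`-th multiple pairs non-trivially with some `y ∈ A[p]`: the orthogonal of `A[p]` is `pA`
(`mem_range_nsmul_of_forall_torsionBy`, with `(ℚ/ℤ)[p] ↪ ℤ/p`). For `A = Ш(E/K)` this is Cassels'
"kernel of `⟨·,·⟩` on `Ш[p]` = `pШ ∩ Ш[p]`". [cite: Cassels1998, §1] [cite: SilvermanAEC2009, Thm. X.4.14] -/
theorem exists_torsion_partner_of_not_divisible [Finite A] (B : A →+ A →+ AddCircle (1 : ℚ))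
    (halt : ∀ x, B x x = 0) (hnd : ∀ x, (∀ y, B x y = 0) → x = 0) (p : ℕ) [Fact p.Prime]
    {x₀ : A} (hx₀ : ∀ z : A, p • z ≠ x₀) : ∃ y : A, p • y = 0 ∧ B x₀ y ≠ 0 := by
  obtain ⟨ι, hι⟩ := exists_circleTorsion_toZMod_injective p
  by_contra hcon
  push Not at hcon
  have hmem : x₀ ∈ (nsmulAddMonoidHom (α := A) p).range :=
    mem_range_nsmul_of_forall_torsionBy p B halt hnd ι hι
      (fun y hy => hcon y (AddSubgroup.torsionBy.nsmul_iff.mp hy))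
  obtain ⟨z, hz⟩ := hmem
  exact hx₀ z (by simpa only [nsmulAddMonoidHom_apply] using hz)

/-- **ONE non-divisible non-zero `p`-torsion element ⇒ `A[p²] = A[p]`** (finite `A`, alternating
non-degenerate `ℚ/ℤ`-pairing, `#A[p] = p²`): the partner `y₀ ∈ A[p]` of `x₀` (previous theorem) makes
`(x₀, y₀)` a Gram pair — `B x₀ x₀ = B y₀ y₀ = 0`, `B x₀ y₀ ≠ 0`, `B y₀ x₀ = −B x₀ y₀ ≠ 0` — and
`sq_nsmul_stable_of_gram` (span by counting, non-degeneracy on `A[p]`, one line of bilinearity)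
concludes. [cite: Cassels1998, §1] [cite: SilvermanAEC2009, Thm. X.4.14] -/
theorem sq_nsmul_stable_of_oneNonDivisible [Finite A] (B : A →+ A →+ AddCircle (1 : ℚ))
    (halt : ∀ x, B x x = 0) (hnd : ∀ x, (∀ y, B x y = 0) → x = 0) {p : ℕ} [Fact p.Prime]
    (hcard : Nat.card (AddSubgroup.torsionBy A p) = p ^ 2)
    (h1 : ∃ x : A, p • x = 0 ∧ x ≠ 0 ∧ ∀ z : A, p • z ≠ x) :
    ∀ x : A, p ^ 2 • x = 0 → p • x = 0 := by
  obtain ⟨x₀, hx₀, -, hx₀nd⟩ := h1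
  obtain ⟨y₀, hy₀, h₁₂⟩ := exists_torsion_partner_of_not_divisible B halt hnd p hx₀nd
  have h₂₁ : B y₀ x₀ ≠ 0 := by
    rw [eq_neg_of_alternating B halt y₀ x₀, neg_ne_zero]
    exact h₁₂
  exact sq_nsmul_stable_of_gram B hx₀ hy₀ (halt x₀) (halt y₀) h₁₂ h₂₁ hcard

/-- Hence, under the same pairing data, ONE non-divisible non-zero `p`-torsion element gives the full
four-line binder of route C9: NO non-zero `p`-torsion element is a `p`-th multiple. [cite: Cassels1998, §1] -/
theorem noDivisibleTorsion_of_oneNonDivisible [Finite A] (B : A →+ A →+ AddCircle (1 : ℚ))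
    (halt : ∀ x, B x x = 0) (hnd : ∀ x, (∀ y, B x y = 0) → x = 0) {p : ℕ} [Fact p.Prime]
    (hcard : Nat.card (AddSubgroup.torsionBy A p) = p ^ 2)
    (h1 : ∃ x : A, p • x = 0 ∧ x ≠ 0 ∧ ∀ z : A, p • z ≠ x) :
    ∀ x : A, p • x = 0 → x ≠ 0 → ∀ z : A, p • z ≠ x :=
  no_divisible_torsion_of_sq_nsmul_stable (sq_nsmul_stable_of_oneNonDivisible B halt hnd hcard h1)

end Algebra

/-! ### §2 Rank `0` over a number field: `Ш[p²] = Ш[p]` from bsd.S18 + ONE line -/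

section General

variable {K : Type*} [Field K] [NumberField K] (W : WeierstrassCurve K) [W.IsElliptic]

/-- **`Ш(E/K)[p²] = Ш(E/K)[p]` from the Cassels–Tate pairing fact and ONE second-`p`-descent line.**
Rank `0` and `p ∤ #E(K)_tors` give `#Ш[p] = #Sel^(p) = p²` (p213922's proved bijection); `Ш` finite
makes the bsd.S18 pairing non-degenerate (a finite group has no non-zero divisible element); then §1.
[cite: SilvermanAEC2009, Thm. X.4.14 and Thm. X.4.2(a)] [cite: Cassels1962ArithmeticIV] [cite: Creutz2014, Thm. 7.2] -/
theorem shaNoPSqTorsion_of_oneNonDivisible_of_card_selmerGroup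
    (hCT : exists_casselsTate_pairing (K := K)) [Finite W.sha] (p : ℕ) [Fact p.Prime]
    (hrank : W.mordellWeilRank = 0) (htors : ¬ p ∣ W.torsionOrder)
    (hcard : Nat.card (W.selmerGroup (p : ℤ)) = p ^ 2)
    (h1 : ∃ x : W.sha, p • x = 0 ∧ x ≠ 0 ∧ ∀ z : W.sha, p • z ≠ x) :
    ∀ x : W.sha, p ^ 2 • x = 0 → p • x = 0 := by
  have hc : Nat.card (AddSubgroup.torsionBy W.sha p) = p ^ 2 := by
    rw [card_torsionBy_coe_eq_card_inf,
      card_sha_inf_torsionBy_eq_card_selmerGroup_of_rankZero W p hrank htors, hcard]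
  obtain ⟨B, halt, hker⟩ := hCT W
  have hnd : ∀ x : W.sha, (∀ y, B x y = 0) → x = 0 := fun x hx => by
    have hmem : x ∈ AddSubgroup.divisibleElements W.sha := (hker x).mp hx
    rwa [divisibleElements_eq_bot_of_finite, AddSubgroup.mem_bot] at hmem
  exact sq_nsmul_stable_of_oneNonDivisible B halt hnd hc h1

/-- Under the same data the FULL route-C9 binder holds: no non-zero `p`-torsion class of `Ш(E/K)` is
divisible by `p` (the other three lines follow from one). [cite: Cassels1962ArithmeticIV] [cite: Creutz2014, Thm. 7.2] -/
theorem sha_noDivisibleTorsion_of_oneNonDivisible_of_card_selmerGroup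
    (hCT : exists_casselsTate_pairing (K := K)) [Finite W.sha] (p : ℕ) [Fact p.Prime]
    (hrank : W.mordellWeilRank = 0) (htors : ¬ p ∣ W.torsionOrder)
    (hcard : Nat.card (W.selmerGroup (p : ℤ)) = p ^ 2)
    (h1 : ∃ x : W.sha, p • x = 0 ∧ x ≠ 0 ∧ ∀ z : W.sha, p • z ≠ x) :
    ∀ x : W.sha, p • x = 0 → x ≠ 0 → ∀ z : W.sha, p • z ≠ x :=
  no_divisible_torsion_of_sq_nsmul_stable
    (shaNoPSqTorsion_of_oneNonDivisible_of_card_selmerGroup W hCT p hrank htors hcard h1)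

/-- **Hence `#Ш(E/K)[p^∞] = p²` EXACTLY** on such a pair. [cite: SilvermanAEC2009, Thm X.4.2(a)] -/
theorem card_primaryComponent_sha_eq_sq_of_oneNonDivisible
    (hCT : exists_casselsTate_pairing (K := K)) [Finite W.sha] (p : ℕ) [Fact p.Prime]
    (hrank : W.mordellWeilRank = 0) (htors : ¬ p ∣ W.torsionOrder)
    (hcard : Nat.card (W.selmerGroup (p : ℤ)) = p ^ 2)
    (h1 : ∃ x : W.sha, p • x = 0 ∧ x ≠ 0 ∧ ∀ z : W.sha, p • z ≠ x) :
    Nat.card (AddCommGroup.primaryComponent W.sha p) = p ^ 2 :=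
  card_primaryComponent_sha_eq_of_sq_of_card_selmerGroup W p hrank htors
    (shaNoPSqTorsion_of_oneNonDivisible_of_card_selmerGroup W hCT p hrank htors hcard h1) hcard

end General

/-! ### §3 Over `ℚ`: Miller's `BSD(E,p)` from GZK + bsd.S18 + `#Sel^(p) = p²` + ONE line -/

section OverQ

variable (W : WeierstrassCurve ℚ) [W.IsElliptic] (p : ℕ) [Fact p.Prime]

/-- **`BSD(E,p)` at a rank-`0` pair from the `p`-descent count, the Cassels–Tate pairing fact and ONE
second-`p`-descent line.** `E/ℚ` of analytic rank `0` (Gross–Zagier–Kolyvagin `hGZK`: rank `0` and `Ш`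
finite), bsd.S18 (`hCT`), `p ∤ #E(ℚ)_tors`, `#Sel^(p)(E/ℚ) = p²` (two descent engines), ONE non-zero
`p`-torsion class of `Ш` not divisible by `p` (`h1`: one route-C9 document pair), `ord_p #Ш_an = 2` ⇒
Miller's `BSD(E,p)`. Class-free, image-free, no pairing value; per curve.
[cite: Creutz2014, Thm. 7.2 and Alg. 7.3] [cite: Cassels1962ArithmeticIV] [cite: Miller2011LMS, §1 and Def. 1.1]
[cite: SilvermanAEC2009, Thm X.4.2(a) and Thm. X.4.14] -/
theorem bsdp_of_oneNonDivisible_of_card_selmerGroup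
    (hCT : exists_casselsTate_pairing (K := ℚ)) (hGZK : rank_eq_analyticRank_of_analyticRank_le_one)
    (hr : W.analyticRank = 0) (htors : ¬ p ∣ W.torsionOrder)
    (hcard : Nat.card (W.selmerGroup (p : ℤ)) = p ^ 2)
    (h1 : ∃ x : W.sha, p • x = 0 ∧ x ≠ 0 ∧ ∀ z : W.sha, p • z ≠ x)
    {q : ℚ} (hq : shaAn W = (q : ℂ)) (hv : padicValRat p q = 2) : BSDp W p := by
  have hr1 : W.analyticRank ≤ 1 := by rw [hr]; norm_num
  have hrank : W.mordellWeilRank = 0 := by rw [(hGZK W hr1).1, hr]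
  haveI : Finite W.sha := (hGZK W hr1).2
  exact bsdp_of_shaNoPSqTorsion_of_card_selmerGroup W p hGZK hr htors hcard
    (shaNoPSqTorsion_of_oneNonDivisible_of_card_selmerGroup W hCT p hrank htors hcard h1)
    hq (by exact_mod_cast hv)

/-- **The exact `p`-part on such a pair: `ord_p #Ш(E/ℚ) = 2`**, no analytic `Ш` value needed.
[cite: Cassels1962ArithmeticIV] [cite: SilvermanAEC2009, Thm X.4.2(a)] -/
theorem padicValNat_shaOrder_eq_two_of_oneNonDivisible
    (hCT : exists_casselsTate_pairing (K := ℚ)) (hGZK : rank_eq_analyticRank_of_analyticRank_le_one)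
    (hr : W.analyticRank = 0) (htors : ¬ p ∣ W.torsionOrder)
    (hcard : Nat.card (W.selmerGroup (p : ℤ)) = p ^ 2)
    (h1 : ∃ x : W.sha, p • x = 0 ∧ x ≠ 0 ∧ ∀ z : W.sha, p • z ≠ x) :
    padicValNat p W.shaOrder = 2 := by
  have hr1 : W.analyticRank ≤ 1 := by rw [hr]; norm_num
  have hrank : W.mordellWeilRank = 0 := by rw [(hGZK W hr1).1, hr]
  haveI : Finite W.sha := (hGZK W hr1).2
  exact padicValNat_shaOrder_eq_of_shaNoPSqTorsion_of_card_selmerGroup W p hGZK hr htors hcard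
    (shaNoPSqTorsion_of_oneNonDivisible_of_card_selmerGroup W hCT p hrank htors hcard h1)

end OverQ

/-! ### §4 The record shape for a literal integer model at `p = 3` (class-free; `E[3]` irreducible kernel-decided) -/

/-- **`BSD(E,3)` from the literal model + bsd.S18 + `#Sel^(3) = 9` + ONE second-3-descent document
pair.** For a globally minimal `W` with integral model `[a₁,…,a₆]`: a good prime `ℓ ≠ 3` with
`#Ẽ(𝔽_ℓ) = n` and `X² − (ℓ+1−n)X + ℓ` root-free mod `3` gives `E[3]` irreducible (Mazur), hence
`3 ∤ #E(ℚ)_tors`; with `r_an = 0`, the Cassels–Tate pairing fact `hCT`, `#Sel^(3)(E/ℚ) = 9`, ONE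
non-zero class of `Ш[3]` not divisible by `3` (`h1`) and `ord₃ #Ш_an = 2`, §3 gives `BSD(E,3)`. Per
pair; not a class theorem; books nothing. [cite: Creutz2014, Thm. 7.2 and Alg. 7.3]
[cite: Cassels1962ArithmeticIV] [cite: Miller2011LMS, Def. 1.1] [cite: Mazur1978, §6 Prop. 6.3 (1) (p. 153)]
[cite: SilvermanAEC2009, Thm X.4.2(a) and Thm. X.4.14] -/
theorem bsdp_three_of_ainvs_of_oneNonDivisible
    (hCT : exists_casselsTate_pairing (K := ℚ)) (hGZK : rank_eq_analyticRank_of_analyticRank_le_one)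
    (a1 a2 a3 a4 a6 : ℤ) {W : WeierstrassCurve ℚ} [W.IsElliptic] [W.IsGloballyMinimal]
    (hW : integralModelInt W = ⟨a1, a2, a3, a4, a6⟩) (ℓ n : ℕ) [Fact ℓ.Prime]
    (hℓ3 : ℓ ≠ 3) (hℓΔ : ¬ (ℓ : ℤ) ∣ discOf [a1, a2, a3, a4, a6])
    (hcnt : Nat.card (((⟨a1, a2, a3, a4, a6⟩ : WeierstrassCurve ℤ).map
      (Int.castRingHom (ZMod ℓ))).toAffine.Point) = n)
    (hnoroot : ∀ t : ℕ, t < 3 → ¬ (3 : ℤ) ∣ (t : ℤ) ^ 2 - ((ℓ : ℤ) + 1 - n) * t + ℓ)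
    (hr : W.analyticRank = 0) (hcard : Nat.card (W.selmerGroup (3 : ℤ)) = 9)
    (h1 : ∃ x : W.sha, 3 • x = 0 ∧ x ≠ 0 ∧ ∀ z : W.sha, 3 • z ≠ x)
    {q : ℚ} (hq : shaAn W = (q : ℂ)) (hv : padicValRat 3 q = 2) : BSDp W 3 := by
  haveI : Fact (Nat.Prime 3) := ⟨by norm_num⟩
  have hΔ : (⟨a1, a2, a3, a4, a6⟩ : WeierstrassCurve ℤ).Δ = discOf [a1, a2, a3, a4, a6] :=
    intCurve_Δ a1 a2 a3 a4 a6
  have hirr : Irr W 3 := by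
    refine hasIrreducibleModPGaloisRep_of_intModel_of_noroot hW 3 ℓ hℓ3 (by rw [hΔ]; exact hℓΔ) hcnt
      (forall_zmod_of_forall_lt fun t ht h0 ↦ hnoroot t ht ?_)
    change ((3 : ℕ) : ℤ) ∣ _
    rw [← ZMod.intCast_zmod_eq_zero_iff_dvd]
    push_cast at h0 ⊢
    linear_combination h0
  exact bsdp_of_oneNonDivisible_of_card_selmerGroup W 3 hCT hGZK hr
    (Supersingular.not_dvd_torsionOrder_of_irr W 3 hirr)
    (by rw [show (3 : ℕ) ^ 2 = 9 by norm_num]; exact hcard) h1 hq hv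

/-- **The exact `3`-part under the same data, no analytic `Ш` value needed: `ord₃ #Ш(E/ℚ) = 2`**
(`#Ш(E/ℚ)[3^∞] = 9`). [cite: Creutz2014, Thm. 7.2] [cite: Cassels1962ArithmeticIV]
[cite: Mazur1978, §6 Prop. 6.3 (1) (p. 153)] [cite: SilvermanAEC2009, Thm X.4.2(a)] -/
theorem padicValNat_shaOrder_three_eq_two_of_ainvs_of_oneNonDivisible
    (hCT : exists_casselsTate_pairing (K := ℚ)) (hGZK : rank_eq_analyticRank_of_analyticRank_le_one)
    (a1 a2 a3 a4 a6 : ℤ) {W : WeierstrassCurve ℚ} [W.IsElliptic] [W.IsGloballyMinimal]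
    (hW : integralModelInt W = ⟨a1, a2, a3, a4, a6⟩) (ℓ n : ℕ) [Fact ℓ.Prime]
    (hℓ3 : ℓ ≠ 3) (hℓΔ : ¬ (ℓ : ℤ) ∣ discOf [a1, a2, a3, a4, a6])
    (hcnt : Nat.card (((⟨a1, a2, a3, a4, a6⟩ : WeierstrassCurve ℤ).map
      (Int.castRingHom (ZMod ℓ))).toAffine.Point) = n)
    (hnoroot : ∀ t : ℕ, t < 3 → ¬ (3 : ℤ) ∣ (t : ℤ) ^ 2 - ((ℓ : ℤ) + 1 - n) * t + ℓ)
    (hr : W.analyticRank = 0) (hcard : Nat.card (W.selmerGroup (3 : ℤ)) = 9)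
    (h1 : ∃ x : W.sha, 3 • x = 0 ∧ x ≠ 0 ∧ ∀ z : W.sha, 3 • z ≠ x) :
    padicValNat 3 W.shaOrder = 2 := by
  haveI : Fact (Nat.Prime 3) := ⟨by norm_num⟩
  have hΔ : (⟨a1, a2, a3, a4, a6⟩ : WeierstrassCurve ℤ).Δ = discOf [a1, a2, a3, a4, a6] :=
    intCurve_Δ a1 a2 a3 a4 a6
  have hirr : Irr W 3 := by
    refine hasIrreducibleModPGaloisRep_of_intModel_of_noroot hW 3 ℓ hℓ3 (by rw [hΔ]; exact hℓΔ) hcnt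
      (forall_zmod_of_forall_lt fun t ht h0 ↦ hnoroot t ht ?_)
    change ((3 : ℕ) : ℤ) ∣ _
    rw [← ZMod.intCast_zmod_eq_zero_iff_dvd]
    push_cast at h0 ⊢
    linear_combination h0
  exact padicValNat_shaOrder_eq_two_of_oneNonDivisible W 3 hCT hGZK hr
    (Supersingular.not_dvd_torsionOrder_of_irr W 3 hirr)
    (by rw [show (3 : ℕ) ^ 2 = 9 by norm_num]; exact hcard) h1

/-- **Discharging the typed missing input of `Typed/X10.lean`** at an X10 pair from the certificates in
their PRINTED shape (`#Sel^(3) = 9`, ONE second-descent emptiness document pair) and bsd.S18.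
Bookkeeping. [cite: Miller2011LMS, Def. 1.1] [cite: Creutz2014, Thm. 7.2] [cite: Cassels1962ArithmeticIV] -/
theorem missingInputAt_of_oneNonDivisible_of_card_selmerThree
    (W : WeierstrassCurve ℚ) [W.IsElliptic] [W.IsGloballyMinimal]
    (hCT : exists_casselsTate_pairing (K := ℚ)) (hGZK : rank_eq_analyticRank_of_analyticRank_le_one)
    (hX : ClassX10 W 3) (hr : W.analyticRank = 0) (hcard : Nat.card (W.selmerGroup (3 : ℤ)) = 9)
    (h1 : ∃ x : W.sha, 3 • x = 0 ∧ x ≠ 0 ∧ ∀ z : W.sha, 3 • z ≠ x)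
    {q : ℚ} (hq : shaAn W = (q : ℂ)) (hv : padicValRat 3 q = 2) : X10.MissingInputAt W := fun _ =>
  haveI : Fact (Nat.Prime 3) := ⟨by norm_num⟩
  haveI : Finite W.sha := (hGZK W hX.analyticRank_le_one).2
  missingPPartAt_of_bsdp W 3
    (bsdp_of_oneNonDivisible_of_card_selmerGroup W 3 hCT hGZK hr (not_three_dvd_torsionOrder_of_classX10 W hX)
      (by rw [show (3 : ℕ) ^ 2 = 9 by norm_num]; exact hcard) h1 hq hv)

end Summit.BirchSwinnertonDyer.Rank1Residual.X10

end
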